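import Mathlib
import HarnessLib
import Summits.NavierStokesRegularity.NavierStokesRegularity.Theorems.PoloidalWindowRigidity.Negative.ResidueRev8False
import Summits.NavierStokesRegularity.NavierStokesRegularity.Theorems.PoloidalWindowRigidity.Negative.DriftProfileNoPeriod

/-!
# Crux `PoloidalWindowRigidity` (K2, stmt-NavierStokesRegularity-19708) — negative side:
# the rev-9 residue stub S2‴ `stub_residueNoPeriodNoSpiral` is FALSE with ClassRates in place of the Oseen-mild identity

Negative-side support (refuter seat ns-regularity-refuter1 gen 2, cell ns-regularity-ideate; D-0081 §C).  Skeleton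
rev 9 of line `slicesharp-screw` (lead ns-poloidal-K2-p1 g2; S2‴ is a THEOREM modulo S2⁗ in rev 10, with the same
hypothesis list plus (vii)) added to the rev-8 residue S2″ two clauses landed by ns-poloidal-K2-p2:
(v′) «no spatial period in any direction» and (vi′) «rotating-self-similar about NO vertical axis, any rate, any centre»
(`∀ c κ, ∃ r, ∃ s < 0, ∃ y, e^r • v (e^{2r} s) (e^r • R_{κr} y + c) ≠ R_{κr} (v s (y + c))`, tree
`…RotatedLerayAllRates.eq_zero_of_spiralSelfSimilar_centre`, p477648).

* `not_spiralSelfSimilar_driftProfile` — (vi′) holds for the drifting discretely self-similar cellular profile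
  `w = driftProfile` ((v′) is `driftProfile_no_common_period`, file `DriftProfileNoPeriod`).  Choice of `r`: if `κ ≠ 0`
  and `c` lies on the `x₁`-axis, `r = π/κ` (the half-turn flips the sign of `w₀` at the centre); otherwise `r` with
  `R_{κr} = id` (`r = 2π/κ`, or `r = 1` when `κ = 0`) and a slice `s = −1/a²` on which the residual shift
  `a(e^{−r} − 1)c + 2r e₁` is a quarter period in a coordinate where `c` is nonzero (or, for `c` on the `x₁`-axis and
  `κ = 0`, a full period plus `2`, and `cos 2 ≠ 1`).  The bookkeeping lemmas `driftProfile_rescaled` /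
  `driftProfile_slice` (the profile on the slice `s = −1/a²` and its parabolic rescaling by `e^r`) are reusable.
* `residueNoPeriodNoSpiral_false_with_classRates_without_mild` — THE CERTIFICATE: the hypothesis list of
  `stub_residueNoPeriodNoSpiral` verbatim, with the Oseen-mild identity (M) REPLACED by the two scale-sharp `ClassRate`
  bounds and (as in `…Negative.ResidueRev8False`, p475628) the any-frame axisymmetry clause deleted, does NOT exclude a
  backward singularity at the apex (`C = 4, C₁ = 8, C₂ = 4`).  So (M) stays THE load-bearing hypothesis of S2‴, and
  (v′), (vi′) are weightless against the standing witness — unlike rev 10's (vii), which cuts it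
  (`…Negative.NearPeakDrift`).

WHAT THIS IS NOT: not a claim about Navier–Stokes — kinematics of an explicit profile. [folklore]
-/

noncomputable section

-- the summit and its single sub-problem share the name (CONVENTIONS §1), as in every Theorems file
set_option linter.dupNamespace false

namespace Summit.NavierStokesRegularity.NavierStokesRegularity.Theorems.PoloidalWindowRigidity.Negative

open Set Function
open scoped RealInnerProductSpace InnerProductSpace Laplacian
open Literature.Analysis Literature.Analysis.FluidPDE

/-! ### Slice bookkeeping -/

/-- `−(e^{2r} · (−1/a²)) = (e^r/a)²`. [folklore] -/
theorem neg_exp_sq_mul_neg_inv_sq (r a : ℝ) :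
    -(Real.exp r ^ 2 * -(a ^ 2)⁻¹) = (Real.exp r / a) ^ 2 := by
  rw [div_pow]
  field_simp

/-- The amplitude of the rescaled slice: `cellAmp (e^{2r} · (−1/a²)) = a / e^r`. [folklore] -/
theorem cellAmp_exp_sq_mul (r : ℝ) {a : ℝ} (ha : 0 < a) :
    cellAmp (Real.exp r ^ 2 * -(a ^ 2)⁻¹) = a / Real.exp r := by
  rw [cellAmp, neg_exp_sq_mul_neg_inv_sq r a, Real.sqrt_sq (by positivity), inv_div]

/-- The drift of the rescaled slice: `log (−(e^{2r} · (−1/a²))) = 2r − 2 log a`. [folklore] -/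
theorem log_exp_sq_mul (r : ℝ) {a : ℝ} (ha : 0 < a) :
    Real.log (-(Real.exp r ^ 2 * -(a ^ 2)⁻¹)) = 2 * r - 2 * Real.log a := by
  rw [neg_exp_sq_mul_neg_inv_sq r a, Real.log_pow, Real.log_div (Real.exp_pos r).ne' ha.ne', Real.log_exp]
  push_cast
  ring

/-- The drift of the slice `s = −1/a²`: `log (−s) = −2 log a`. [folklore] -/
theorem log_neg_neg_inv_sq (a : ℝ) : Real.log (-(-(a ^ 2)⁻¹)) = -(2 * Real.log a) := by
  rw [neg_neg, Real.log_inv, Real.log_pow]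
  push_cast
  ring

/-- **The parabolic `e^r`-rescaling of the slice `s = −1/a²`**:
`e^r • w(e^{2r}s, x) = a • V((a/e^r) • x + (2r − 2 log a) • e₁)`. [folklore] -/
theorem driftProfile_rescaled (r : ℝ) {a : ℝ} (ha : 0 < a) (x : EuclideanSpace ℝ (Fin 3)) :
    Real.exp r • driftProfile (Real.exp r ^ 2 * -(a ^ 2)⁻¹) x =
      a • cellField ((a / Real.exp r) • x + (2 * r - 2 * Real.log a) • EuclideanSpace.single (1 : Fin 3) (1 : ℝ)) := by
  simp only [driftProfile, driftShift, cellAmp_exp_sq_mul r ha, log_exp_sq_mul r ha, smul_smul]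
  rw [show Real.exp r * (a / Real.exp r) = a by field_simp]

/-- **The slice `s = −1/a²`**: `w(s, x) = a • V(a • x − 2 log a • e₁)`. [folklore] -/
theorem driftProfile_slice {a : ℝ} (ha : 0 < a) (x : EuclideanSpace ℝ (Fin 3)) :
    driftProfile (-(a ^ 2)⁻¹) x =
      a • cellField (a • x + (-(2 * Real.log a)) • EuclideanSpace.single (1 : Fin 3) (1 : ℝ)) := by
  simp only [driftProfile, driftShift, cellAmp_neg_inv_sq ha, log_neg_neg_inv_sq a]

/-- The base point `y = −c + (2 log a / a) e₁` is mapped by the slice-`s` similarity variable onto the origin. [folklore] -/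
theorem slice_shift_basePoint {a : ℝ} (ha : 0 < a) (c : EuclideanSpace ℝ (Fin 3)) :
    a • ((-c + (2 * Real.log a / a) • EuclideanSpace.single (1 : Fin 3) (1 : ℝ)) + c) +
        (-(2 * Real.log a)) • EuclideanSpace.single (1 : Fin 3) (1 : ℝ) = 0 := by
  rw [show -c + (2 * Real.log a / a) • EuclideanSpace.single (1 : Fin 3) (1 : ℝ) + c =
      (2 * Real.log a / a) • EuclideanSpace.single (1 : Fin 3) (1 : ℝ) by abel,
    smul_smul, mul_div_cancel₀ _ ha.ne', ← add_smul, add_neg_cancel, zero_smul]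

/-- … and by the rescaled similarity variable onto the residual shift `a(e^{−r} − 1) c + 2r e₁`. [folklore] -/
theorem rescaled_shift_basePoint (r : ℝ) {a : ℝ} (ha : 0 < a) (c : EuclideanSpace ℝ (Fin 3)) :
    (a / Real.exp r) • (Real.exp r • (-c + (2 * Real.log a / a) • EuclideanSpace.single (1 : Fin 3) (1 : ℝ)) + c) +
        (2 * r - 2 * Real.log a) • EuclideanSpace.single (1 : Fin 3) (1 : ℝ) =
      (a * ((Real.exp r)⁻¹ - 1)) • c + (2 * r) • EuclideanSpace.single (1 : Fin 3) (1 : ℝ) := by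
  have he := (Real.exp_pos r).ne'
  ext i
  simp only [PiLp.add_apply, PiLp.smul_apply, PiLp.neg_apply, smul_eq_mul]
  field_simp
  ring

/-- A rotation by an angle with `cos = 1`, `sin = 0` is the identity. [folklore] -/
theorem rotZ_eq_self_of_cos_eq_one {θ : ℝ} (hc : Real.cos θ = 1) (hs : Real.sin θ = 0)
    (x : EuclideanSpace ℝ (Fin 3)) : rotZ θ x = x := by
  ext i
  fin_cases i <;> simp [hc, hs]

/-- `cos 2 ≠ 1`. [folklore] -/
theorem cos_two_ne_one : Real.cos 2 ≠ 1 := by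
  intro h
  have hlt : (2 : ℝ) < 2 * Real.pi := by linarith [Real.pi_gt_three]
  have hgt : -(2 * Real.pi) < (2 : ℝ) := by linarith [Real.pi_pos]
  have := (Real.cos_eq_one_iff_of_lt_of_lt hgt hlt).1 h
  norm_num at this

/-- `cos (π / (2|q|) · q) = 0` for `q ≠ 0` (a quarter period). [folklore] -/
theorem cos_quarter_period {q : ℝ} (hq : q ≠ 0) : Real.cos (Real.pi / (2 * |q|) * q) = 0 := by
  rcases lt_or_gt_of_ne hq with h | h
  · rw [abs_of_neg h, show Real.pi / (2 * -q) * q = -(Real.pi / 2) by field_simp, Real.cos_neg,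
      Real.cos_pi_div_two]
  · rw [abs_of_pos h, show Real.pi / (2 * q) * q = Real.pi / 2 by field_simp, Real.cos_pi_div_two]

/-- `cos (2π/|q| · q + x) = cos x` for `q ≠ 0` (a full period). [folklore] -/
theorem cos_full_period_add {q : ℝ} (hq : q ≠ 0) (x : ℝ) : Real.cos (2 * Real.pi / |q| * q + x) = Real.cos x := by
  rcases lt_or_gt_of_ne hq with h | h
  · rw [abs_of_neg h, show 2 * Real.pi / -q * q + x = x - 2 * Real.pi by field_simp; ring, Real.cos_sub_two_pi]
  · rw [abs_of_pos h, show 2 * Real.pi / q * q + x = x + 2 * Real.pi by field_simp; ring, Real.cos_add_two_pi]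

/-! ### The clause -/

/-- **(vi′) The drifting profile is rotating-self-similar about NO vertical axis**: for every centre `c` and every
angular rate `κ` there are `r`, `s < 0`, `y` with `e^r • w(e^{2r}s, e^r • R_{κr} y + c) ≠ R_{κr} (w(s, y + c))`. [folklore] -/
theorem not_spiralSelfSimilar_driftProfile (c : EuclideanSpace ℝ (Fin 3)) (κ : ℝ) :
    ∃ r : ℝ, ∃ s < 0, ∃ y : EuclideanSpace ℝ (Fin 3),
      Real.exp r • driftProfile (Real.exp r ^ 2 * s) (Real.exp r • rotZ (κ * r) y + c) ≠
        rotZ (κ * r) (driftProfile s (y + c)) := by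
  by_cases hI : c 0 = 0 ∧ c 2 = 0 ∧ κ ≠ 0
  · -- ### Case I: `c` on the `x₁`-axis, `κ ≠ 0`: half a turn, `r = π/κ`, slice `s = −1`, `y = −c`
    obtain ⟨hc0, hc2, hκ⟩ := hI
    refine ⟨Real.pi / κ, -((1 : ℝ) ^ 2)⁻¹, by norm_num, -c, ?_⟩
    have hθ : κ * (Real.pi / κ) = Real.pi := by field_simp
    rw [hθ, driftProfile_rescaled (Real.pi / κ) one_pos, driftProfile_slice one_pos]
    intro h
    have h0 := congrArg (fun w : EuclideanSpace ℝ (Fin 3) => w 0) h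
    simp [cellField_apply_zero, hc0, hc2] at h0
    norm_num at h0
  · -- ### Case II: a rotation by a full turn (or none), and a well-chosen slice
    by_cases hII : c 0 ≠ 0 ∨ c 2 ≠ 0
    · -- `R_{κr} = id` with `r ≠ 0`
      obtain ⟨r, hr, hcos, hsin⟩ : ∃ r : ℝ, r ≠ 0 ∧ Real.cos (κ * r) = 1 ∧ Real.sin (κ * r) = 0 := by
        by_cases hκ : κ = 0
        · exact ⟨1, one_ne_zero, by simp [hκ], by simp [hκ]⟩
        · have h2 : κ * (2 * Real.pi / κ) = 2 * Real.pi := by field_simp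
          exact ⟨2 * Real.pi / κ, div_ne_zero (by positivity) hκ, by rw [h2]; exact Real.cos_two_pi,
            by rw [h2]; exact Real.sin_two_pi⟩
      have hK0 : (Real.exp r)⁻¹ - 1 ≠ 0 := by
        rw [sub_ne_zero, ← Real.exp_neg]
        intro h1
        exact hr (neg_eq_zero.1 ((Real.exp_eq_one_iff _).1 h1))
      -- the coordinate `i ∈ {0, 2}` in which `c` is nonzero, and the quarter-period amplitude
      obtain ⟨i, hi, hci⟩ : ∃ i : Fin 3, (i = 0 ∨ i = 2) ∧ c i ≠ 0 := by
        rcases hII with h0 | h2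
        · exact ⟨0, Or.inl rfl, h0⟩
        · exact ⟨2, Or.inr rfl, h2⟩
      have hq : ((Real.exp r)⁻¹ - 1) * c i ≠ 0 := mul_ne_zero hK0 hci
      set a : ℝ := Real.pi / (2 * |((Real.exp r)⁻¹ - 1) * c i|) with ha_def
      have ha : 0 < a := by positivity
      have hquarter : Real.cos (a * ((Real.exp r)⁻¹ - 1) * c i) = 0 := by
        rw [mul_assoc]
        exact cos_quarter_period hq
      refine ⟨r, -(a ^ 2)⁻¹, by
        have : 0 < (a ^ 2)⁻¹ := by positivity
        linarith, -c + (2 * Real.log a / a) • EuclideanSpace.single (1 : Fin 3) (1 : ℝ), ?_⟩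
      rw [rotZ_eq_self_of_cos_eq_one hcos hsin, rotZ_eq_self_of_cos_eq_one hcos hsin,
        driftProfile_rescaled r ha, rescaled_shift_basePoint r ha, driftProfile_slice ha, slice_shift_basePoint ha]
      set X : EuclideanSpace ℝ (Fin 3) :=
        (a * ((Real.exp r)⁻¹ - 1)) • c + (2 * r) • EuclideanSpace.single (1 : Fin 3) (1 : ℝ) with hX
      have hX0 : X 0 = a * ((Real.exp r)⁻¹ - 1) * c 0 := by simp [hX, mul_assoc]
      have hX2 : X 2 = a * ((Real.exp r)⁻¹ - 1) * c 2 := by simp [hX, mul_assoc]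
      have hprod : Real.cos (X 2) * Real.cos (X 0) = 0 := by
        rcases hi with rfl | rfl
        · rw [hX0, hquarter, mul_zero]
        · rw [hX2, hquarter, zero_mul]
      intro h
      have h0 := congrArg (fun w : EuclideanSpace ℝ (Fin 3) => w 0) h
      simp only [PiLp.smul_apply, smul_eq_mul, cellField_apply_zero] at h0
      rw [hprod] at h0
      simp at h0
      exact ha.ne' h0.symm
    · -- `c` on the `x₁`-axis and (by Case I) `κ = 0`: `r = 1`, compare the `x₁`-components
      push Not at hII
      obtain ⟨hc0, hc2⟩ := hII
      have hκ : κ = 0 := by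
        by_contra hκ
        exact hI ⟨hc0, hc2, hκ⟩
      have hK0 : (Real.exp 1)⁻¹ - 1 ≠ 0 := by
        rw [sub_ne_zero, ← Real.exp_neg]
        intro h1
        have := (Real.exp_eq_one_iff _).1 h1
        norm_num at this
      -- amplitude: a full period in the `x₁`-coordinate of the residual shift (any amplitude if `c₁ = 0`)
      obtain ⟨a, ha, hper⟩ : ∃ a : ℝ, 0 < a ∧
          Real.cos (a * ((Real.exp 1)⁻¹ - 1) * c 1 + 2) = Real.cos 2 := by
        by_cases hc1 : c 1 = 0
        · exact ⟨1, one_pos, by simp [hc1]⟩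
        · refine ⟨2 * Real.pi / |((Real.exp 1)⁻¹ - 1) * c 1|, by positivity, ?_⟩
          rw [mul_assoc]
          exact cos_full_period_add (mul_ne_zero hK0 hc1) 2
      refine ⟨1, -(a ^ 2)⁻¹, by
        have : 0 < (a ^ 2)⁻¹ := by positivity
        linarith, -c + (2 * Real.log a / a) • EuclideanSpace.single (1 : Fin 3) (1 : ℝ), ?_⟩
      rw [hκ, zero_mul, rotZ_zero, rotZ_zero, driftProfile_rescaled 1 ha, rescaled_shift_basePoint 1 ha,
        driftProfile_slice ha, slice_shift_basePoint ha]
      intro h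
      have h1 := congrArg (fun w : EuclideanSpace ℝ (Fin 3) => w 1) h
      simp [cellField_apply_one, hc2] at h1
      -- `h1 : a * cos (a K c₁ + 2) = a` (or an equivalent normal form)
      rw [hper] at h1
      have hcos2 : Real.cos 2 = 1 := mul_left_cancel₀ ha.ne' (h1.trans (mul_one a).symm)
      exact cos_two_ne_one hcos2


/-! ### The certificate for rev 9 -/

/-- **S2‴ without (M) is FALSE.** The hypothesis list of `stub_residueNoPeriodNoSpiral` (skeleton rev 9/10 of line
`slicesharp-screw`) verbatim — Type-I rate, joint continuity, divergence-free, poloidal and frozen vorticity, vorticity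
direction non-constant, not vertically rigid, flat in no horizontal direction, translation-invariant along no line, not
scale-invariant about the apex, screw-invariant about no vertical axis, the no-source-gauge clause, no vertical period,
sub-critical strain exceeded for every `Λ < 1`, (v′) no spatial period, (vi′) rotating-self-similar about no vertical axis —
with the Oseen-mild identity REPLACED by the two `ClassRate` slice bounds `‖Dv‖ ≤ C₁/(−t)`, `‖curl v‖ ≤ C₂/(−t)` and the
any-frame axisymmetry clause deleted, does NOT exclude a backward singularity at the apex: the drifting cellular profile
(`C = 4, C₁ = 8, C₂ = 4`). [folklore] -/
theorem residueNoPeriodNoSpiral_false_with_classRates_without_mild :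
    ¬ (∀ (C C₁ C₂ : ℝ) (v : ℝ → EuclideanSpace ℝ (Fin 3) → EuclideanSpace ℝ (Fin 3)),
      Literature.Analysis.FluidPDE.HasTypeITimeDecay C v →
      ContinuousOn (Function.uncurry v) (Set.Iio (0 : ℝ) ×ˢ Set.univ) →
      (∀ t < 0, ∀ y, ‖fderiv ℝ (v t) y‖ ≤ C₁ / (-t)) →
      (∀ t < 0, ∀ y, ‖Literature.Analysis.FluidPDE.curl (v t) y‖ ≤ C₂ / (-t)) →
      (∀ t < 0, Literature.Analysis.FluidPDE.VectorCalculus.IsDivFree (v t)) →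
      (∀ s < 0, ∀ y, ⟪Literature.Analysis.FluidPDE.curl (v s) y, EuclideanSpace.single 2 1⟫_ℝ = 0) →
      (∀ s < 0, ∀ y, ⟪fderiv ℝ (v s) y (Literature.Analysis.FluidPDE.curl (v s) y), EuclideanSpace.single 2 1⟫_ℝ = 0) →
      (∀ s < 0, ∀ b : EuclideanSpace ℝ (Fin 3), b ≠ 0 → ∃ y,
        Literature.Analysis.FluidPDE.cross (Literature.Analysis.FluidPDE.curl (v s) y) b ≠ 0) →
      (∀ s < 0, ∃ y, fderiv ℝ (v s) y (EuclideanSpace.single 2 1) 0 ≠ 0 ∨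
        fderiv ℝ (v s) y (EuclideanSpace.single 2 1) 1 ≠ 0) →
      (∀ s < 0, ∀ a : EuclideanSpace ℝ (Fin 3), a ≠ 0 → ⟪a, EuclideanSpace.single 2 1⟫_ℝ = 0 →
        ∃ y, ⟪fderiv ℝ (v s) y a, EuclideanSpace.single 2 1⟫_ℝ ≠ 0) →
      (∀ s < 0, ∀ e : EuclideanSpace ℝ (Fin 3), e ≠ 0 → ∃ (y : EuclideanSpace ℝ (Fin 3)) (l : ℝ), v s (y + l • e) ≠ v s y) →
      (∃ lam : ℝ, 0 < lam ∧ ∃ s < 0, ∃ y, lam • v (lam ^ 2 * s) (lam • y) ≠ v s y) →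
      (∀ κ : ℝ, κ ≠ 0 → ∀ c : EuclideanSpace ℝ (Fin 3), ∃ s < 0, ∃ (a : ℝ) (y : EuclideanSpace ℝ (Fin 3)),
        v s (c + Literature.Analysis.FluidPDE.rotZ (κ * a) (y - c) + a • EuclideanSpace.single 2 (1 : ℝ)) ≠
          Literature.Analysis.FluidPDE.rotZ (κ * a) (v s y)) →
      (∀ (ψ : ℝ → EuclideanSpace ℝ (Fin 3) → ℝ) (src : ℝ → ℝ) (x₀ : EuclideanSpace ℝ (Fin 3)) (ε : ℝ → ℝ),
        ContDiffOn ℝ 2 (Function.uncurry ψ) (Set.Iio (0 : ℝ) ×ˢ Set.univ) →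
        (∀ t < 0, ∀ y, Literature.Analysis.FluidPDE.curl (v t) y 0 = fderiv ℝ (ψ t) y (EuclideanSpace.single 1 1) ∧
          Literature.Analysis.FluidPDE.curl (v t) y 1 = -fderiv ℝ (ψ t) y (EuclideanSpace.single 0 1)) →
        (∀ t < 0, ∀ x, |ψ t x - ψ t x₀| ≤ ε t * ‖x - x₀‖) →
        ContinuousOn ε (Set.Iio 0) →
        Filter.Tendsto (fun t => ε t * Real.sqrt (-t)) Filter.atBot (nhds 0) →
        ∃ t < 0, ∃ x, deriv (fun τ => ψ τ x) t + fderiv ℝ (ψ t) x (v t x) - (Δ (ψ t)) x ≠ src t) →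
      (∀ L : ℝ, 0 < L → ∃ s < 0, ∃ y, v s (y + L • EuclideanSpace.single 2 (1 : ℝ)) ≠ v s y) →
      (∀ Λ : ℝ, Λ < 1 → ∃ s < 0, ∃ (y a : EuclideanSpace ℝ (Fin 3)), ⟪a, EuclideanSpace.single 2 (1 : ℝ)⟫_ℝ = 0 ∧
        Λ * ‖a‖ ^ 2 < (-s) * ⟪fderiv ℝ (v s) y a, a⟫_ℝ) →
      (∀ ℓ : EuclideanSpace ℝ (Fin 3), ℓ ≠ 0 → ∃ s < 0, ∃ y, v s (y + ℓ) ≠ v s y) →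
      (∀ (c : EuclideanSpace ℝ (Fin 3)) (κ : ℝ), ∃ (r : ℝ), ∃ s < 0, ∃ y,
        Real.exp r • v (Real.exp r ^ 2 * s) (Real.exp r • Literature.Analysis.FluidPDE.rotZ (κ * r) y + c) ≠
          Literature.Analysis.FluidPDE.rotZ (κ * r) (v s (y + c))) →
      ¬ Literature.Analysis.FluidPDE.IsBackwardSingularPoint v 0) := by
  intro h
  refine h 4 8 4 driftProfile hasTypeITimeDecay_driftProfile continuousOn_driftProfile
    (fun t ht y => norm_fderiv_driftProfile_le ht y) (fun t ht y => norm_curl_driftProfile_le ht y)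
    (fun t _ => isDivFree_driftProfile t) (fun s _ y => poloidal_driftProfile s y)
    (fun s _ y => frozen_driftProfile s y)
    (fun s hs b hb => vorticityDirection_nonconstant_driftProfile hs b hb)
    (fun s hs => (not_vertRigid_driftProfile hs).imp fun _ h => Or.inl h)
    (fun s hs a ha ha2 => flat_in_no_horizontal_direction_driftProfile hs a ha ha2)
    (fun s hs e he => not_translationInvariant_driftProfile hs e he)
    ⟨2, two_pos, -1, by norm_num, 0, not_scaleInvariant_driftProfile⟩
    (fun κ _ c => ⟨-1, by norm_num, Real.pi / 2, not_screwInvariant_driftProfile (κ * (Real.pi / 2)) c⟩)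
    (fun ψ src _ _ hψ hstr _ _ _ => noSourceGauge_driftProfile ψ src hψ hstr)
    (fun L hL => driftProfile_no_vertical_period L hL)
    (fun Λ hΛ => driftProfile_critical_strain Λ hΛ)
    (fun ℓ hℓ => driftProfile_no_common_period ℓ hℓ)
    (fun c κ => not_spiralSelfSimilar_driftProfile c κ)
    isBackwardSingularPoint_driftProfile

end Summit.NavierStokesRegularity.NavierStokesRegularity.Theorems.PoloidalWindowRigidity.Negative

end
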